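import Literature.NumberTheory.EllipticCurves.IwasawaSelmerDualProofs
import HarnessLib

/-!
# Carrier witness for the binder `D : W.SelmerDualData κ γ` of the cruxes `OrdKatoHalfAtTwo` /
# `OrdEisensteinHalfAtTwo` (route ByReductionTypeAtTwo / TwoAdicConverse; seat bsd-2adic-ord GEN 6,
# planner request bsd-2adic-plan g12 2026-08-26T02:54:36Z)

HONEST FRAMING (cell `bsd-2adic`, run/shared/lean/pub/bsd-2adic/): tribunal hygiene only. The tribunal
kernel's T-carrier check looks for a term / `Nonempty` lemma for the hypothesis-structure
`WeierstrassCurve.SelmerDualData W κ γ` (the Iwasawa module `X(E/K_∞)` packaged with its `Λ`-action,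
`Literature/NumberTheory/EllipticCurves/IwasawaSelmer.lean`). The tree CONSTRUCTS it
(`WeierstrassCurve.selmerDualData`, `IwasawaSelmerDualProofs.lean` :341, discharging the named fact
`nonempty_selmerDualData` ibid. :361); this file only re-exports that construction as `Nonempty`
statements the kernel's `exact?` finds in a module it imports automatically. Two theorems, no
definition, no named fact, nothing asserted, nothing booked.
-/

set_option autoImplicit false

noncomputable section

universe u

open Literature.NumberTheory.EllipticCurves

namespace Summit.BirchSwinnertonDyer.BirchSwinnertonDyer.Theorems

/-- **The Iwasawa module `X(E/K_∞)` exists as a `SelmerDualData` term** for every Weierstrass curve over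
a number field, every prime `p`, every `ℤ_p`-extension `κ` and every topological generator `γ` of
`Gal(K_∞/K)` (the tree's construction `WeierstrassCurve.selmerDualData`: the Pontryagin dual
`Hom(Sel_{p^∞}(E/K_∞), ℚ/ℤ)` with `T = γ − 1`). [cite: GreenbergLNM1716, §1 p. 53 (X_E(F_∞) = Hom(Sel_E(F_∞)_p, ℚ_p/ℤ_p))] -/
theorem selmerDualData_nonempty {K : Type u} [Field K] [NumberField K] (W : WeierstrassCurve K)
    {p : ℕ} [Fact p.Prime] (κ : ZpExtension K p) {γ : Field.absoluteGaloisGroup K}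
    (hγ : κ.IsTopGenerator γ) : Nonempty (W.SelmerDualData κ γ) :=
  ⟨W.selmerDualData κ hγ⟩

/-- **The case `K = ℚ`, `p = 2`** of `selmerDualData_nonempty` — the carrier of the binder
`D : W.SelmerDualData κ γ` in `OrdKatoHalfAtTwo` / `OrdEisensteinHalfAtTwo` and in every X5 door at `2`.
[cite: GreenbergLNM1716, §1 p. 53] -/
theorem selmerDualData_nonempty_two (W : WeierstrassCurve ℚ) (κ : ZpExtension ℚ 2)
    {γ : Field.absoluteGaloisGroup ℚ} (hγ : κ.IsTopGenerator γ) : Nonempty (W.SelmerDualData κ γ) :=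
  selmerDualData_nonempty W κ hγ

end Summit.BirchSwinnertonDyer.BirchSwinnertonDyer.Theorems

end
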